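import Summits.AtomisticToContinuum.FouriersLaw.Theorems.EmbeddedDrudeMourreAbelThermodynamicLimitAnchoredCorrelationTails
import Literature.MathematicalPhysics.KineticTheory.InfiniteChainGibbsInvariance
import Literature.MathematicalPhysics.KineticTheory.InfiniteChainCurrentMoments
import Mathlib.MeasureTheory.Integral.Layercake
import Literature.Analysis.FunctionSpaces.TorusLipschitzFourierH1
import Literature.Analysis.FunctionSpaces.WeakCompactnessL1Proofs

/-!
# Leaf (B₀) `stub_fixedTimeOffsetMatching` of S4, glue part 1: truncation tools, layer cake, and the
severed → infinite-dynamics limit under the witness state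
(crux `EmbeddedDrudeMourre.AbelThermodynamicLimit`, item stmt-AtomisticToContinuum-12596, line
`loomis-compact-horizon-witness`; `--supports` file proving the registered sub-goal `stub_severedToInfiniteDynamics`;
closes nothing)

The registered leaf (B₀) — per-offset fixed-time two-dynamics matching of the open `N`-chain pair correlation
`⟨j_{c_N}(0) j_{c_N+x}(t)⟩_{N,T}` with `∫ j_0 (j_x ∘ φ_t) dμT` — is reduced (part 3, `…FixedTimeOffsetMatchingOfLeaves`)
to its two registered halves `stub_centralWindowEnsembleEquivalence` (static) and
`stub_centralWindowDynamicalMatching` (dynamic). This part supplies generic tools of that reduction: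

* §1 the clamp `h_M = max(-M, min(M, ·))`, the truncation inequality `|ab − h_M(a)h_M(b)| ≤ (1 + a⁴ + b⁴)/M` and its
  integrated form `|∫ab − ∫h_M(a)h_M(b)| ≤ (1 + ∫a⁴ + ∫b⁴)/M`;
* §2 layer cake: setwise convergence on the super-level sets of a bounded measurable `f ≥ 0` gives `∫ f dν_n → ∫ f dμ`;
* §3 two integrands that are `δ`-close outside an event of probability `≤ δ` have `M(1+2M)δ`-close clamped pairings;
* §4 `stub_severedToInfiniteDynamics`: for a dynamics `D` with `D.carrier ⊆ bmGood` preserving `μT`,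
  `∫ h_M(j_0) h_M(j_x ∘ T^{Λ_R}_t) dμT → ∫ h_M(j_0) h_M(j_x ∘ D.flow t) dμT` as `R → ∞` (`Λ_R = {-R,…,R}`, `T^Λ_t` the
  severed flow of `InfiniteChainSevered`): on the carrier the severed orbits converge coordinatewise to the
  Buttà–Marchioro flow (`exists_bmDynamics`, BM (3.3)), which is `D.flow` there by the `unique` field; dominated
  convergence.

All statements proved; `[folklore]`. No definitions.
-/

noncomputable section

namespace Summit.AtomisticToContinuum.FouriersLaw.Theorems.AbelThermodynamicLimit.LoomisCompactHorizonWitness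

open MeasureTheory ProbabilityTheory Set Filter Topology Function
open scoped NNReal ENNReal
open Literature.MathematicalPhysics.KineticTheory Literature.MathematicalPhysics.KineticTheory.HeatConduction
open Literature.Probability.Process OscillatorChain
open Literature.Analysis.FunctionSpaces (abs_max_neg_min_le abs_clamp_le_abs abs_clamp_sub_clamp_le)
open Summit.AtomisticToContinuum.FouriersLaw.Theorems.NonBallistic
open Summit.AtomisticToContinuum.FouriersLaw.Theorems.SubdiffusiveBondHeat
open Summit.AtomisticToContinuum.FouriersLaw.Theorems.LightConeBondHeat (pinnedChain_abs_bondCurrent_le_exp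
  quarter_inv_temp_admissible)

/-! ### §1 The clamp `h_M(r) = max(-M, min(M, r))` -/

section Clamp

/-- `|r - h_M(r)| ≤ r² / M` for `M > 0`. [folklore] -/
theorem abs_sub_clamp_le_sq_div {M : ℝ} (hM : 0 < M) (r : ℝ) : |r - max (-M) (min M r)| ≤ r ^ 2 / M := by
  rcases le_total r (-M) with h | h
  · rw [min_eq_right (by linarith), max_eq_left h]
    have h1 : |r - -M| = -r - M := by rw [abs_of_nonpos (by linarith)]; ring
    rw [h1, le_div_iff₀ hM]
    nlinarith
  rcases le_total r M with h' | h'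
  · rw [min_eq_right h', max_eq_right h, sub_self, abs_zero]
    positivity
  · rw [min_eq_left h', max_eq_right (by linarith), abs_of_nonneg (by linarith), le_div_iff₀ hM]
    nlinarith

/-- **The truncation inequality** `|a b - h_M(a) h_M(b)| ≤ (1 + a⁴ + b⁴) / M` (`M > 0`). [folklore] -/
theorem abs_mul_sub_clamp_mul_clamp_le {M : ℝ} (hM : 0 < M) (a b : ℝ) :
    |a * b - max (-M) (min M a) * max (-M) (min M b)| ≤ (1 + a ^ 4 + b ^ 4) / M := by
  set ha := max (-M) (min M a) with hha
  set hb := max (-M) (min M b) with hhb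
  have h1 : |a - ha| ≤ a ^ 2 / M := abs_sub_clamp_le_sq_div hM a
  have h2 : |b - hb| ≤ b ^ 2 / M := abs_sub_clamp_le_sq_div hM b
  have h3 : |ha| ≤ |a| := abs_clamp_le_abs hM.le a
  have e : a * b - ha * hb = (a - ha) * b + ha * (b - hb) := by ring
  calc |a * b - ha * hb| = |(a - ha) * b + ha * (b - hb)| := by rw [e]
    _ ≤ |(a - ha) * b| + |ha * (b - hb)| := abs_add_le _ _
    _ = |a - ha| * |b| + |ha| * |b - hb| := by rw [abs_mul, abs_mul]
    _ ≤ a ^ 2 / M * |b| + |a| * (b ^ 2 / M) := by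
        gcongr
    _ = (a ^ 2 * |b| + |a| * b ^ 2) / M := by ring
    _ ≤ (1 + a ^ 4 + b ^ 4) / M := by
        apply div_le_div_of_nonneg_right _ hM.le
        have hb0 := abs_nonneg b
        have ha0 := abs_nonneg a
        have hb2 : |b| ^ 2 = b ^ 2 := sq_abs b
        have ha2 : |a| ^ 2 = a ^ 2 := sq_abs a
        nlinarith [sq_nonneg (a ^ 2 - |b|), sq_nonneg (|a| - b ^ 2), sq_nonneg (a ^ 2 - 1),
          sq_nonneg (b ^ 2 - 1), sq_nonneg a, sq_nonneg b]

/-- Continuity of the clamp. [folklore] -/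
theorem continuous_clamp (M : ℝ) : Continuous fun r : ℝ => max (-M) (min M r) := by fun_prop

end Clamp

/-! ### §1b The integrated truncation inequality -/

section IntegratedTruncation

/-- **The truncation bound on the product**: for integrands `a, b` with finite fourth moments,
`|∫ a b - ∫ h_M(a) h_M(b)| ≤ (1 + ∫ a⁴ + ∫ b⁴) / M`. [folklore] -/
theorem abs_integral_mul_sub_integral_clamp_le {Ω : Type*} [MeasurableSpace Ω] (ρ : Measure Ω) [IsProbabilityMeasure ρ]
    {a b : Ω → ℝ} (ha : Measurable a) (hb : Measurable b) (hab : Integrable (fun q => a q * b q) ρ)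
    (ha4 : Integrable (fun q => a q ^ 4) ρ) (hb4 : Integrable (fun q => b q ^ 4) ρ) {M : ℝ} (hM : 0 < M) :
    |(∫ q, a q * b q ∂ρ) - ∫ q, max (-M) (min M (a q)) * max (-M) (min M (b q)) ∂ρ| ≤
      (1 + (∫ q, a q ^ 4 ∂ρ) + ∫ q, b q ^ 4 ∂ρ) / M := by
  have hhm : Measurable fun q => max (-M) (min M (a q)) * max (-M) (min M (b q)) :=
    ((continuous_clamp M).measurable.comp ha).mul ((continuous_clamp M).measurable.comp hb)
  have hhi : Integrable (fun q => max (-M) (min M (a q)) * max (-M) (min M (b q))) ρ := by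
    refine (integrable_const (M * M)).mono' hhm.aestronglyMeasurable (Eventually.of_forall fun q => ?_)
    rw [Real.norm_eq_abs, abs_mul]
    exact mul_le_mul (abs_max_neg_min_le hM.le _) (abs_max_neg_min_le hM.le _) (abs_nonneg _) hM.le
  rw [← integral_sub hab hhi]
  calc |∫ q, (a q * b q - max (-M) (min M (a q)) * max (-M) (min M (b q))) ∂ρ|
      ≤ ∫ q, |a q * b q - max (-M) (min M (a q)) * max (-M) (min M (b q))| ∂ρ := abs_integral_le_integral_abs
    _ ≤ ∫ q, (1 + a q ^ 4 + b q ^ 4) / M ∂ρ := by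
        refine integral_mono (hab.sub hhi).abs (((integrable_const 1).add ha4).add hb4 |>.div_const M) fun q => ?_
        exact abs_mul_sub_clamp_mul_clamp_le hM (a q) (b q)
    _ = (1 + (∫ q, a q ^ 4 ∂ρ) + ∫ q, b q ^ 4 ∂ρ) / M := by
        rw [integral_div]
        congr 1
        have h1 : Integrable (fun q => (1:ℝ) + a q ^ 4) ρ := (integrable_const 1).add ha4
        have e1 : ∫ q, 1 + a q ^ 4 + b q ^ 4 ∂ρ = (∫ q, 1 + a q ^ 4 ∂ρ) + ∫ q, b q ^ 4 ∂ρ := integral_add h1 hb4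
        have e2 : ∫ q, 1 + a q ^ 4 ∂ρ = (∫ q, (1:ℝ) ∂ρ) + ∫ q, a q ^ 4 ∂ρ := integral_add (integrable_const 1) ha4
        rw [e1, e2, integral_const, smul_eq_mul, probReal_univ, one_mul]

end IntegratedTruncation

/-! ### §2 Layer cake: setwise convergence on super-level sets gives convergence of integrals -/

section LayerCake

variable {β : Type*} [MeasurableSpace β]

/-- **Setwise convergence on the super-level sets of a bounded non-negative measurable function gives
convergence of its integrals** (layer-cake formula + dominated convergence on `(0, C]`). [folklore] -/
theorem tendsto_integral_of_tendsto_measureReal_superlevel (ν : ℕ → Measure β) [∀ n, IsProbabilityMeasure (ν n)]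
    (μ : Measure β) [IsProbabilityMeasure μ] {f : β → ℝ} (hf : Measurable f) {C : ℝ} (hf0 : ∀ b, 0 ≤ f b)
    (hfC : ∀ b, f b ≤ C)
    (h : ∀ s : ℝ, 0 < s → Tendsto (fun n => (ν n).real {b | s < f b}) atTop (𝓝 (μ.real {b | s < f b}))) :
    Tendsto (fun n => ∫ b, f b ∂(ν n)) atTop (𝓝 (∫ b, f b ∂μ)) := by
  have hC : 0 ≤ C := by
    by_contra hC
    haveI : Nonempty β := by
      by_contra he
      rw [not_nonempty_iff] at he
      exact absurd (IsProbabilityMeasure.measure_univ (μ := μ)) (by simp [Set.univ_eq_empty_iff.mpr he])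
    obtain ⟨b⟩ := ‹Nonempty β›
    linarith [hf0 b, hfC b]
  have hint : ∀ (ρ : Measure β) [IsProbabilityMeasure ρ], Integrable f ρ := fun ρ _ =>
    (integrable_const C).mono' hf.aestronglyMeasurable
      (Eventually.of_forall fun b => by rw [Real.norm_eq_abs, abs_of_nonneg (hf0 b)]; exact hfC b)
  have hlc : ∀ (ρ : Measure β) [IsProbabilityMeasure ρ],
      ∫ b, f b ∂ρ = ∫ t in Ioi (0:ℝ), ρ.real {b | t < f b} := fun ρ _ =>
    (hint ρ).integral_eq_integral_meas_lt (Eventually.of_forall hf0)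
  simp_rw [hlc]
  have hmeas : ∀ (ρ : Measure β) [IsProbabilityMeasure ρ], Measurable fun t : ℝ => ρ.real {b | t < f b} := by
    intro ρ _
    refine Antitone.measurable fun s t hst => ?_
    exact measureReal_mono (fun b hb => lt_of_le_of_lt hst hb) (measure_ne_top ρ _)
  refine tendsto_integral_of_dominated_convergence (fun t => (Ioc (0:ℝ) C).indicator (fun _ => (1:ℝ)) t)
    (fun n => (hmeas (ν n)).aestronglyMeasurable) ?_ (fun n => ?_) ?_
  · exact (integrable_indicator_iff measurableSet_Ioc).2 (integrableOn_const (measure_Ioc_lt_top.ne))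
  · refine (ae_restrict_iff' measurableSet_Ioi).2 (Eventually.of_forall fun t ht => ?_)
    rw [Real.norm_eq_abs, abs_of_nonneg measureReal_nonneg]
    by_cases htC : t ≤ C
    · rw [Set.indicator_of_mem (show t ∈ Ioc (0:ℝ) C from ⟨ht, htC⟩)]
      exact measureReal_le_one
    · rw [Set.indicator_of_notMem (show t ∉ Ioc (0:ℝ) C from fun h => htC h.2)]
      have : {b | t < f b} = ∅ := Set.eq_empty_of_forall_notMem fun b hb => htC ((le_of_lt hb).trans (hfC b))
      rw [this, measureReal_empty]
  · exact (ae_restrict_iff' measurableSet_Ioi).2 (Eventually.of_forall fun t ht => h t ht)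

end LayerCake

/-! ### §3 Two bounded integrands that agree in probability have close clamped pairings -/

section InProbability

/-- If `ρ{δ < |b - b'|} ≤ δ` then `|∫ h_M(a) h_M(b) dρ − ∫ h_M(a) h_M(b') dρ| ≤ M (1 + 2M) δ` (`|h_M| ≤ M`, `h_M`
`1`-Lipschitz). [folklore] -/
theorem abs_integral_clamp_mul_clamp_sub_le_of_measure_lt {Ω : Type*} [MeasurableSpace Ω] (ρ : Measure Ω)
    [IsProbabilityMeasure ρ] {a b b' : Ω → ℝ} (ha : Measurable a) (hb : Measurable b) (hb' : Measurable b')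
    {M δ : ℝ} (hM : 0 < M) (hδ : 0 < δ) (hbad : ρ {q | δ < |b q - b' q|} ≤ ENNReal.ofReal δ) :
    |(∫ q, max (-M) (min M (a q)) * max (-M) (min M (b q)) ∂ρ) -
        ∫ q, max (-M) (min M (a q)) * max (-M) (min M (b' q)) ∂ρ| ≤ M * (1 + 2 * M) * δ := by
  have hcm : Measurable fun r : ℝ => max (-M) (min M r) := (continuous_clamp M).measurable
  set ha' := fun q => max (-M) (min M (a q)) with hha'
  set hb1 := fun q => max (-M) (min M (b q)) with hhb1
  set hb2 := fun q => max (-M) (min M (b' q)) with hhb2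
  have hm1 : Measurable fun q => ha' q * hb1 q := (hcm.comp ha).mul (hcm.comp hb)
  have hm2 : Measurable fun q => ha' q * hb2 q := (hcm.comp ha).mul (hcm.comp hb')
  have hbd : ∀ (u v : Ω → ℝ) (q : Ω), |max (-M) (min M (u q)) * max (-M) (min M (v q))| ≤ M * M := fun u v q => by
    rw [abs_mul]; exact mul_le_mul (abs_max_neg_min_le hM.le _) (abs_max_neg_min_le hM.le _) (abs_nonneg _) hM.le
  have hi1 : Integrable (fun q => ha' q * hb1 q) ρ := (integrable_const (M * M)).mono' hm1.aestronglyMeasurable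
    (Eventually.of_forall fun q => by rw [Real.norm_eq_abs]; exact hbd a b q)
  have hi2 : Integrable (fun q => ha' q * hb2 q) ρ := (integrable_const (M * M)).mono' hm2.aestronglyMeasurable
    (Eventually.of_forall fun q => by rw [Real.norm_eq_abs]; exact hbd a b' q)
  set S : Set Ω := {q | δ < |b q - b' q|} with hS
  have hSm : MeasurableSet S := measurableSet_lt measurable_const ((hb.sub hb').abs)
  have hpt : ∀ q, |ha' q * hb1 q - ha' q * hb2 q| ≤ M * (δ + 2 * M * S.indicator (fun _ => (1:ℝ)) q) := by
    intro q
    rw [← mul_sub, abs_mul]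
    refine mul_le_mul (abs_max_neg_min_le hM.le _) ?_ (abs_nonneg _) hM.le
    by_cases hq : q ∈ S
    · rw [Set.indicator_of_mem hq, mul_one]
      calc |hb1 q - hb2 q| ≤ |hb1 q| + |hb2 q| := abs_sub _ _
        _ ≤ M + M := add_le_add (abs_max_neg_min_le hM.le _) (abs_max_neg_min_le hM.le _)
        _ ≤ δ + 2 * M := by linarith
    · rw [Set.indicator_of_notMem hq, mul_zero, add_zero]
      have hq' : |b q - b' q| ≤ δ := by
        simp only [hS, Set.mem_setOf_eq, not_lt] at hq; exact hq
      exact (abs_clamp_sub_clamp_le M _ _).trans hq'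
  have hSi : Integrable (S.indicator fun _ => (1:ℝ)) ρ := (integrable_const (1:ℝ)).indicator hSm
  have hSreal : ρ.real S ≤ δ := ENNReal.toReal_le_of_le_ofReal hδ.le hbad
  rw [← integral_sub hi1 hi2]
  calc |∫ q, (ha' q * hb1 q - ha' q * hb2 q) ∂ρ| ≤ ∫ q, |ha' q * hb1 q - ha' q * hb2 q| ∂ρ :=
        abs_integral_le_integral_abs
    _ ≤ ∫ q, M * (δ + 2 * M * S.indicator (fun _ => (1:ℝ)) q) ∂ρ :=
        integral_mono (hi1.sub hi2).abs (((integrable_const δ).add (hSi.const_mul (2 * M))).const_mul M) hpt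
    _ = M * (δ + 2 * M * ρ.real S) := by
        rw [integral_const_mul]
        congr 1
        have e1 : ∫ q, (δ + 2 * M * S.indicator (fun _ => (1:ℝ)) q) ∂ρ =
            (∫ _q, δ ∂ρ) + ∫ q, 2 * M * S.indicator (fun _ => (1:ℝ)) q ∂ρ :=
          integral_add (integrable_const δ) (hSi.const_mul (2 * M))
        rw [e1, integral_const, smul_eq_mul, probReal_univ, one_mul, integral_const_mul,
          integral_indicator_const _ hSm, smul_eq_mul, mul_one]
    _ ≤ M * (1 + 2 * M) * δ := by
        have : 2 * M * ρ.real S ≤ 2 * M * δ := mul_le_mul_of_nonneg_left hSreal (by positivity)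
        nlinarith

end InProbability

/-! ### §4 The severed flows in growing boxes recover the infinite dynamics under the witness state -/

section SeveredLimit

variable {ω₂ lam β γ : ℝ} (hω : 0 < ω₂) (hl : 0 < lam) (hβ : 0 < β)

include hω hl hβ in
/-- **Severed → infinite dynamics under the witness state.** For `D.carrier ⊆ bmGood` and `D` preserving `μT`,
`∫ h_M(j_0) h_M(j_x ∘ T^{Λ_R}_t) dμT → ∫ h_M(j_0) h_M(j_x ∘ φ_t) dμT` as `R → ∞` (`Λ_R = {-R,…,R}`): on the carrier the
severed orbits converge coordinatewise to the Buttà–Marchioro flow (`exists_bmDynamics`), which is `D.flow` there by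
uniqueness; dominated convergence. [folklore] -/
theorem tendsto_integral_clamp_bondCurrentZ_severedFlow (hB1 : (pinnedChain ω₂ lam β γ).CondB1)
    {μT : Measure ChainConfig} [IsProbabilityMeasure μT] (D : InfiniteChainDynamics (pinnedChain ω₂ lam β γ))
    (hcar : D.carrier ⊆ (pinnedChain ω₂ lam β γ).bmGood) (hPres : D.PreservesMeasure μT) (t : ℝ) (x : ℤ) {M : ℝ}
    (hM : 0 ≤ M) :
    Tendsto (fun R : ℕ => ∫ σ, max (-M) (min M ((pinnedChain ω₂ lam β γ).bondCurrentZ σ 0)) *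
        max (-M) (min M ((pinnedChain ω₂ lam β γ).bondCurrentZ
          (severedFlow hB1 (Finset.Icc (-(R : ℤ)) R) t σ) x)) ∂μT) atTop
      (𝓝 (∫ σ, max (-M) (min M ((pinnedChain ω₂ lam β γ).bondCurrentZ σ 0)) *
        max (-M) (min M ((pinnedChain ω₂ lam β γ).bondCurrentZ (D.flow t σ) x)) ∂μT)) := by
  have hU : ContDiff ℝ 2 (pinnedChain ω₂ lam β γ).U := (pinnedChain_isEvenPolyOfDegree_U β γ hω.le hl).contDiff_two
  have hV : ContDiff ℝ 2 (pinnedChain ω₂ lam β γ).V := (pinnedChain_isEvenPolyOfDegree_V ω₂ lam γ hβ).contDiff_two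
  obtain ⟨D₀, hD₀, -, -, -, hrep, -, -⟩ := exists_bmDynamics (P := pinnedChain ω₂ lam β γ) (s₁ := 2) (s₂ := 2)
    (by norm_num) (by norm_num) (pinnedChain_isEvenPolyOfDegree_U β γ hω.le hl) (pinnedChain_isEvenPolyOfDegree_V ω₂ lam γ hβ)
  have hcm : Measurable fun r : ℝ => max (-M) (min M r) := (continuous_clamp M).measurable
  have hFm : ∀ R : ℕ, AEStronglyMeasurable (fun σ => max (-M) (min M ((pinnedChain ω₂ lam β γ).bondCurrentZ σ 0)) *
      max (-M) (min M ((pinnedChain ω₂ lam β γ).bondCurrentZ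
        (severedFlow hB1 (Finset.Icc (-(R : ℤ)) R) t σ) x))) μT := fun R =>
    ((hcm.comp (measurable_bondCurrentZ (pinnedChain ω₂ lam β γ) 0)).mul
      (hcm.comp ((measurable_bondCurrentZ (pinnedChain ω₂ lam β γ) x).comp
        (measurable_severedFlow hB1 _ hU hV t)))).aestronglyMeasurable
  refine tendsto_integral_of_dominated_convergence (fun _ => M * M) hFm (integrable_const _)
    (fun R => Eventually.of_forall fun σ => ?_) ?_
  · rw [Real.norm_eq_abs, abs_mul]
    exact mul_le_mul (abs_max_neg_min_le hM _) (abs_max_neg_min_le hM _) (abs_nonneg _) hM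
  · filter_upwards [hPres.1] with σ hσ
    have hσg : σ ∈ (pinnedChain ω₂ lam β γ).bmGood := hcar hσ
    have hflow : D.flow t σ = D₀.flow t σ := by
      have h := D₀.unique (fun u => D.flow u σ) (fun u => hD₀.symm ▸ hcar (D.flow_mem hσ u)) (D.isSolution σ hσ) t
      simpa only [D.flow_zero σ hσ] using h
    have hcoord : ∀ i : ℤ, Tendsto (fun R : ℕ => severedFlow hB1 (Finset.Icc (-(R : ℤ)) R) t σ i) atTop
        (𝓝 (D.flow t σ i)) := by
      intro i
      have h := hrep hB1 σ hσg t 0 i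
      simp only [zero_sub, zero_add] at h
      rw [hflow]
      exact h
    have hg : Continuous fun u : (ℝ × ℝ) × (ℝ × ℝ) =>
        -((u.1.2 + u.2.2) / 2 * deriv (pinnedChain ω₂ lam β γ).V (u.2.1 - u.1.1)) := by
      have hdV : Continuous (deriv (pinnedChain ω₂ lam β γ).V) := hV.continuous_deriv (by norm_num)
      fun_prop
    have hj : Tendsto (fun R : ℕ => (pinnedChain ω₂ lam β γ).bondCurrentZ
        (severedFlow hB1 (Finset.Icc (-(R : ℤ)) R) t σ) x) atTop
        (𝓝 ((pinnedChain ω₂ lam β γ).bondCurrentZ (D.flow t σ) x)) :=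
      (hg.tendsto _).comp ((hcoord x).prodMk_nhds (hcoord (x + 1)))
    exact tendsto_const_nhds.mul (((continuous_clamp M).tendsto _).comp hj)

end SeveredLimit


/-- **Registered sub-goal `stub_severedToInfiniteDynamics`** (leaf (B₀) of S4, line `loomis-compact-horizon-witness`):
the severed Hamiltonian flows of the growing centred boxes recover the infinite dynamics of a `bmGood`-carried witness
under its invariant state, tested on the clamped current pairing (`tendsto_integral_clamp_bondCurrentZ_severedFlow`,
closed form). [folklore] -/
theorem stub_severedToInfiniteDynamics :
    ∀ ω₂ lam β γ : ℝ, 0 < ω₂ → 0 < lam → 0 < β →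
      ∀ (hB1 : (Literature.MathematicalPhysics.KineticTheory.HeatConduction.pinnedChain ω₂ lam β γ).CondB1)
        (μT : MeasureTheory.Measure Literature.MathematicalPhysics.KineticTheory.HeatConduction.ChainConfig),
        MeasureTheory.IsProbabilityMeasure μT →
      ∀ (D : Literature.MathematicalPhysics.KineticTheory.HeatConduction.InfiniteChainDynamics
          (Literature.MathematicalPhysics.KineticTheory.HeatConduction.pinnedChain ω₂ lam β γ)),
        D.carrier ⊆ (Literature.MathematicalPhysics.KineticTheory.HeatConduction.pinnedChain ω₂ lam β γ).bmGood →
        D.PreservesMeasure μT →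
      ∀ (t : ℝ) (x : ℤ) (M : ℝ), 0 ≤ M →
        Filter.Tendsto (fun R : ℕ => ∫ σ,
            max (-M) (min M ((Literature.MathematicalPhysics.KineticTheory.HeatConduction.pinnedChain
              ω₂ lam β γ).bondCurrentZ σ 0)) *
            max (-M) (min M ((Literature.MathematicalPhysics.KineticTheory.HeatConduction.pinnedChain
              ω₂ lam β γ).bondCurrentZ
                (Literature.MathematicalPhysics.KineticTheory.HeatConduction.OscillatorChain.severedFlow hB1
                  (Finset.Icc (-(R : ℤ)) R) t σ) x)) ∂μT)
          Filter.atTop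
          (nhds (∫ σ,
            max (-M) (min M ((Literature.MathematicalPhysics.KineticTheory.HeatConduction.pinnedChain
              ω₂ lam β γ).bondCurrentZ σ 0)) *
            max (-M) (min M ((Literature.MathematicalPhysics.KineticTheory.HeatConduction.pinnedChain
              ω₂ lam β γ).bondCurrentZ (D.flow t σ) x)) ∂μT)) :=
  fun _ _ _ _ hω hl hβ hB1 _ _ D hcar hPres t x _ hM =>
    tendsto_integral_clamp_bondCurrentZ_severedFlow hω hl hβ hB1 D hcar hPres t x hM

end Summit.AtomisticToContinuum.FouriersLaw.Theorems.AbelThermodynamicLimit.LoomisCompactHorizonWitness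

end
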